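import Mathlib
import HarnessLib
import Literature.NumberTheory.Transcendental.LindemannWeierstrassProofs
import Summits.Schanuel.Schanuel.Theses.CyclotomicRigidity

/-!
# Birth skeleton (BC3) — crux `CyclotomicRigidity.TowerSchanuel` (stmt-Schanuel-5988)

Route `route-Schanuel-CyclotomicRigidity` (Summits/Schanuel/Schanuel/Theses/CyclotomicRigidity.lean),
crux #5 **TowerSchanuel** — SCHANUEL ON THE KERNEL-FREE TOWER: for `z₁,…,zₙ ∈ E` linearly
independent over `ℚ`, `trdeg_ℚ ℚ(z, e^z) ≥ n`, where
`E = sInf {K : IntermediateField ℚ ℂ | ℚ̄ ≤ K ∧ exp K ⊆ K}` is the smallest exp-closed subfield of `ℂ`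
containing `ℚ̄ = algebraicClosure ℚ ℂ` (`E₀ = ℚ̄`, `E₁ = ℚ̄(e^ℚ̄)` the Lindemann–Weierstrass field, …).
Registrar seat `planner-skel-stmt-Schanuel-5988-0` (skeleton-register, 2026-08-17; route re-audit bin
REPAIRABLE). This file types the crux's own proof map ("every step of the tower is generic; induction
on levels", route header) as FOUR NAMED PIECES and a kernel-checked composition.

## The line — induct up finite sub-towers; at the top of a GENERIC sub-tower a new exponential can only go algebraic through a LOGARITHM OF AN ALGEBRAIC NUMBER

Work with FINITE SUB-TOWERS instead of levels: a sequence `W = (W₀,…,W_{D−1}) ⊂ E` in which every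
`W_j` is algebraic over `ℚ(e^{W₀},…,e^{W_{j−1}})` (so `W₀ ∈ ℚ̄`, `W₁ ∈ ℚ̄(e^{W₀})^{alg} ∩ E`, …). For a
`ℚ`-linearly independent sub-tower, "generic" means `e^{W₀},…,e^{W_{D−1}}` algebraically independent
over `ℚ`; TowerSchanuel is equivalent to "every ℚ-linearly independent finite sub-tower of `E` is
generic" (Macintyre1991 §3, freeness of the constant tower), but that equivalence is NOT a stub here —
it is split along the seam below and the two halves of the bookkeeping are separate TRUE stubs.

THE SEAM (the dichotomy at the top of a generic sub-tower). Let `W` be generic and `w ∈ E` algebraic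
over `F = ℚ(e^W)` (the next tower element). If `e^w` is ALSO algebraic over `F` — the only way
genericity can die one step up — then either
* (log sector) `w ≡ Σ q_j W_j (mod exp⁻¹(ℚ̄))` with a NON-ZERO logarithm `u = w − Σ q_j W_j ∈ E`,
  `e^u ∈ ℚ̄` — excluded by **`LogFreeTower`** (the route's crux #4, stmt-Schanuel-5987: Hermite–Lindemann
  up the tower, `E ∩ exp⁻¹(ℚ̄) = {0}`; it is where the route's Galois/Kummer mechanism bites, support
  `GalExtImpliesLogFree`), or
* (free sector) no such congruence exists — excluded by the NEW stub **`stub_stepModLogs`**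
  ("the generic step modulo logarithms": an exponential of a tower element that is algebraic over a
  generic sub-tower field is an algebraic number times a rational monomial, `e^w ∈ ℚ̄ · e^{span_ℚ W}`).
So `LogFreeTower ∧ stub_stepModLogs ⟹` every independent finite sub-tower is generic
(`algIndep_exp_prefix`, induction on the length `D`; base `D = 0` is empty, and the first step
`W₀ ∈ ℚ̄∖0 ⟹ e^{W₀} ∉ ℚ̄` is the Hermite–Lindemann slice of `LogFreeTower`). The two TRUE stubs then turn
genericity of sub-towers into the crux: **`stub_towerBasis`** (every ℚ-independent tuple `z ⊂ E` is an
INTEGER combination `z = A·W` of some ℚ-independent finite sub-tower `W ⊂ E` — the union-of-sub-towers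
description of the `sInf`, pruned to a basis and rescaled) and **`stub_laurentMonomials`** (Laurent
monomials `Π_j y_j^{A_ij}` with ℚ-independent exponent rows in algebraically independent non-zero
`y_j` are algebraically independent), whence `e^{z_i} = Π_j (e^{W_j})^{A_ij}` are algebraically
independent and `trdeg_ℚ ℚ(z, e^z) ≥ n` (`AlgebraicIndependent.cardinalMk_le_trdeg`).

Both open stubs are CONSEQUENCES of TowerSchanuel (so the split loses nothing): for `stub_stepModLogs`,
if `w ∉ span_ℚ W` then `(W, w)` is ℚ-independent in `E` while `ℚ(W, w, e^W, e^w)` is algebraic over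
`ℚ(e^W)` of trdeg `≤ D`, contradicting TowerSchanuel, and if `w ∈ span_ℚ W` take `q` with `u = 0`;
for `LogFreeTower` see the route header (predimension + the two TRUE stubs). Neither open stub visibly
gives the other: `stub_stepModLogs` does not see `e^e ∉ ℚ̄` (its instance `W = (1)`, `w = e` would hold
with `q = 0` even if `e^e` were algebraic), and `LogFreeTower` says nothing about an `e^w` that is
transcendental but algebraic over `ℚ(e)`.

## Stubs (registered verbatim; `Sig.stub_*` are the statements, `stub_*` the sorried theorems)

1. `stub_towerBasis` — TRUE (structural; size L in Lean): finite sub-towers carry `E`.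
2. `stub_laurentMonomials` — TRUE (algebra, folklore; size M): independent Laurent monomials.
3. `stub_logFreeTower : LogFreeTower` — OPEN; literally the route item stmt-Schanuel-5987 (crux #4), so
   it closes by name when that item is proved (`GalExtImpliesLogFree ∘ GalExtTower` is the route's plan).
4. `stub_stepModLogs` — OPEN, LOAD-BEARING and new: the generic step modulo logarithms (hardest stub).
`TowerSchanuel_of : Sig.stub_towerBasis → Sig.stub_laurentMonomials → LogFreeTower →
Sig.stub_stepModLogs → TowerSchanuel` is sorry-free (axioms propext / Classical.choice / Quot.sound);
`TowerSchanuel_proof : TowerSchanuel` is the skeleton in its final shape (depends on `sorryAx` only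
through the four `stub_*`). `towerSchanuel_of_algebraic` is the sorry-free LEVEL-0 SPECIAL CASE of the
crux (`z ⊂ ℚ̄`, from the tree's Lindemann–Weierstrass `LindemannWeierstrass.AlgIndep_holds`) — BC5-style
evidence that the definitions compute.

## Disproof used / negatives

No `Cruxes/TowerSchanuel/Disproof.lean` exists (`ledger crux ls stmt-Schanuel-5988`: no workfiles,
2026-08-17), no `Theorems/TowerSchanuel/Negative/` lemmas, dead lines: none. `ledger negatives
--problem Schanuel` (2 refuted statements, both `PolarPhantoms` trdeg-upper-bound claims
`trdeg ℚ(y, α) < n`): neither stub is equal or trivially equivalent to them (every stub here is a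
LOWER bound / independence statement or a structural lemma). Crux evidence read: idea
`tower-level2-quarter` (Diaz large-trdeg + transcendence measures: TowerSchanuel up to ⌈(N+2)/4⌉ on
progression lines) — a partial engine inside the free sector, compatible with this split (it would
attack `stub_stepModLogs` on progression sub-towers `W = (β)`, `w = polynomial in e^β`).

## BC3 audit (this seat; raw outputs under `birth-certificate:` in the seat's NOTES.md, files `bc/` of its folder)

`lean check --json` rc 0, `sorries` = 4 = the four `stub_*` (zero elsewhere); audit block:
`TowerSchanuel_of` proof.conditional on exactly {Sig.stub_towerBasis, Sig.stub_laurentMonomials,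
Sig.stub_stepModLogs} + the registered item `LogFreeTower`; `algIndep_exp_prefix` /
`rows_linearIndependent` / `le_trdeg_of_algIndep_exp` closed; `#print axioms TowerSchanuel_of` =
[propext, Classical.choice, Quot.sound]. Probes, for each `X ∈ {Sig.stub_towerBasis,
Sig.stub_laurentMonomials, LogFreeTower, Sig.stub_stepModLogs}` and each target
`T ∈ {TowerSchanuel, Schanuel}`, all under `maxHeartbeats 400000`:
(1) the literal `example : X → T := by first | exact? | simpa | aesop` (also in the BC.md form
`… | simpa [X] | (unfold X; simpa) | aesop` and the `(h : X)` form) FAILS 24/24 — the combinator dies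
inside `exact?` with a whnf heartbeat time-out, which `first` does not catch; (1b) `exact?` ALONE with
the target heads made `local irreducible` (so a by-name hit cannot hide behind the time-out) FAILS 8/8
(7 × "`exact?` could not close the goal", 1 whnf time-out); (2) the closers one at a time — `simpa`,
`aesop`, `simpa [X]`, `unfold X; simpa`, and `(h : X) ⊢ T` by `simpa using h` / `aesop` /
`unfold … ; aesop` — FAIL 56/56 ("aesop: failed to prove the goal after exhaustive search" / "made no
progress"; simp closes nothing); (3) vacuity guard: `X` itself and `¬ X` by `aesop` / `simp [X]` FAIL
20/20 (no stub is closed or refuted outright). No stub is cheaply the crux or the summit: stubs 1–2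
are theorems-to-be, stub 3 is the strictly lower rung crux #4, stub 4 knows nothing about logarithms
of algebraic numbers.

## References

* A. Macintyre, *Schanuel's conjecture and free exponential rings*, Ann. Pure Appl. Logic 51 (1991)
  §3. [Macintyre1991]
* J. Kirby, *Finitely presented exponential fields*, Algebra & Number Theory 7 (2013), arXiv:0912.4019,
  Prop. 6.11. [Kirby2013FPEF]
* J. Kirby, A. Macintyre, A. Onshuus, *The algebraic numbers definable in various exponential fields*,
  arXiv:1101.4224, §2.1. [KirbyMacintyreOnshuus2012]
* M. Bays, J. Kirby, A. Wilkie, *A Schanuel property for exponentially transcendental powers*,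
  Bull. LMS 42 (2010). [BaysKirbyWilkie2010]
* J. Ax, *On Schanuel's conjectures*, Ann. of Math. 93 (1971). [Ax1971]
* A. Baker, *Transcendental Number Theory* (1975), Ch. 1 (Hermite–Lindemann, Lindemann–Weierstrass).
  [BakerTNT1975]
* S. Lang, *Introduction to transcendental numbers* (1966), pp. 30–31. [Lang1966]
* M. Waldschmidt, *Diophantine approximation on linear algebraic groups* (2000), Conj. 1.14.
  [Waldschmidt2000]
* tree: `Literature.NumberTheory.Transcendental.LindemannWeierstrass.AlgIndep_holds` (PROVED).
-/

-- `Summit.<Summit>.<Problem>`: for the single-conjunct summit `Schanuel` the duplicate is mandated.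
set_option linter.dupNamespace false
set_option linter.unusedVariables false

noncomputable section

namespace Summit.Schanuel.Schanuel.Cruxes.TowerSchanuel.Birth

open Summit.Schanuel.Schanuel.Theses.CyclotomicRigidity

/-! ### Stub signatures

Conventions. `E` is inlined verbatim as in the route file. A FINITE SUB-TOWER is a pair
`(D : ℕ) (W : ℕ → ℂ)` (only the entries `W 0, …, W (D-1)` matter) with
`∀ j < D, IsAlgebraic (Algebra.adjoin ℚ (Set.range fun i : Fin j => Complex.exp (W i))) (W j)` —
`W j` algebraic over the ring `ℚ[e^{W 0}, …, e^{W (j-1)}]` (equivalently over its fraction field);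
prefixes of sub-towers are sub-towers by construction, which is what makes the induction painless. -/

/-- **STUB 1 — finite sub-towers carry `E` (TRUE; structural, size L).** Every ℚ-linearly
independent tuple `z : Fin n → E` is an INTEGER combination `z i = Σ_j A i j · W j` of a ℚ-linearly
independent finite sub-tower `W 0, …, W (D-1)` of elements of `E` (`W j` algebraic over
`ℚ[e^{W 0},…,e^{W (j-1)}]`). Proof sketch: the set of `x ∈ E` algebraic over `ℚ(e^W)` for SOME finite
sub-tower `W ⊂ E` is an intermediate field containing `ℚ̄` and closed under `exp` (concatenate
sub-towers; append `x` itself before exponentiating), hence all of `E` (`sInf_le`); for a tuple,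
concatenate the sub-towers of the `z i`, append `z`, prune left-to-right to a ℚ-basis (a dropped entry is
a ℚ-combination of earlier kept ones, so its exponential is a radical of a monomial in theirs — the
sub-tower property survives by transitivity of algebraicity), and divide by a common denominator.
Leans on: Mathlib `IntermediateField` lattice API, `Algebra.IsAlgebraic.trans`, `exists_linearIndependent`.
Sources: Macintyre1991 §3 (the constant tower `lim Frac(R_n[Γ_n])`), arXiv:math/9805045 §2 (towers for
EL numbers). -/
def Sig.stub_towerBasis : Prop :=
  ∀ (n : ℕ) (z : Fin n → ℂ),
    (∀ i, z i ∈ (sInf {K : IntermediateField ℚ ℂ | algebraicClosure ℚ ℂ ≤ K ∧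
      ∀ w ∈ K, Complex.exp w ∈ K} : IntermediateField ℚ ℂ)) →
    LinearIndependent ℚ z →
    ∃ (D : ℕ) (W : ℕ → ℂ) (A : Fin n → Fin D → ℤ),
      (∀ j : ℕ, j < D → W j ∈ (sInf {K : IntermediateField ℚ ℂ | algebraicClosure ℚ ℂ ≤ K ∧
        ∀ w ∈ K, Complex.exp w ∈ K} : IntermediateField ℚ ℂ)) ∧
      (∀ j : ℕ, j < D → IsAlgebraic
        (Algebra.adjoin ℚ (Set.range fun i : Fin j => Complex.exp (W i))) (W j)) ∧
      LinearIndependent ℚ (fun j : Fin D => W j) ∧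
      ∀ i, z i = ∑ j : Fin D, (A i j : ℂ) * W j

/-- **STUB 2 — independent Laurent monomials (TRUE; folklore algebra, size M).** If
`y : Fin D → ℂ` is algebraically independent over `ℚ` with all `y j ≠ 0`, and the integer exponent
matrix `A : Fin n → Fin D → ℤ` has ℚ-linearly independent rows, then the Laurent monomials
`i ↦ Π_j (y j) ^ (A i j)` are algebraically independent over `ℚ`. Proof sketch: `ℚ[X^{±1}] → ℂ`,
`X ↦ y`, is injective; distinct multi-indices `k ∈ ℕ^n` give distinct exponent vectors `k·A ∈ ℤ^D`
(row independence), so a polynomial relation among the `X^{A_i}` is a Laurent polynomial with the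
same coefficients, hence zero. Leans on: Mathlib `AlgebraicIndependent`, `AddMonoidAlgebra`/`Finsupp`
uniqueness of expansions (or `trdeg` sandwiching). Sources: Ax1971 §1 (multiplicative independence
bookkeeping); Lang, *Algebra*, VIII §1. -/
def Sig.stub_laurentMonomials : Prop :=
  ∀ (n D : ℕ) (y : Fin D → ℂ) (A : Fin n → Fin D → ℤ),
    AlgebraicIndependent ℚ y → (∀ j, y j ≠ 0) →
    LinearIndependent ℚ (fun i => fun j => (A i j : ℚ)) →
    AlgebraicIndependent ℚ (fun i => ∏ j : Fin D, y j ^ (A i j))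

/-- **STUB 4 — the generic step modulo logarithms (OPEN; LOAD-BEARING, the hardest stub).** Let
`W 0,…,W (D-1) ∈ E` be a ℚ-linearly independent finite sub-tower that is GENERIC
(`e^{W 0},…,e^{W (D-1)}` algebraically independent over `ℚ`), and let `w ∈ E` be such that BOTH `w`
and `e^w` are algebraic over `ℚ[e^{W 0},…,e^{W (D-1)}]`. Then `w` is a rational combination of the
`W j` UP TO A LOGARITHM OF AN ALGEBRAIC NUMBER: `e^{w − Σ_j q j · W j} ∈ ℚ̄` for some `q : Fin D → ℚ`
(equivalently `e^w ∈ ℚ̄ · e^{span_ℚ W}` after passing to radicals). Why plausibly true: it is implied by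
TowerSchanuel (if `w ∉ span_ℚ W`, `(W, w)` is ℚ-independent in `E` but `ℚ(W, w, e^W, e^w)` is algebraic
over `ℚ(e^W)`, of trdeg `≤ D`), and it is the natural "multiplicative/Kummer" shadow of freeness of the
step `E_k → E_{k+1}` (Macintyre1991 §3; Kirby2013FPEF Prop. 6.11): the only exponentials of tower
elements algebraic over a generic sub-tower field should be algebraic multiples of rational monomials.
Why it might fail: iff Schanuel fails inside the tower in the free sector (a hidden algebraic relation
`P(e^{W}, e^{w}) = 0` with `w ∈ ℚ(e^W)^{alg} ∩ E` not explained by a logarithm — e.g. `e^{e}` algebraic over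
`ℚ(e)` but `∉ ℚ̄·e^{ℚ}`); no unconditional engine controls `e^w` at a transcendental `w ∈ E₁` (barrier
`AxSchanuelFunctionalNotNumerical`: `E ⊂ ecl(∅)`; partial engine: idea tower-level2-quarter on
progression sub-towers). NOT the crux reworded: it does not see logarithms of algebraic numbers at all
(its instance `W = (1)`, `w = e` would hold with `q = 0` even if `e^e` were algebraic). Sources: Macintyre1991, Kirby2013FPEF,
BaysKirbyWilkie2010 (the exponentially-transcendental analogue, proved via Ax1971), Lang1966. -/
def Sig.stub_stepModLogs : Prop :=
  ∀ (D : ℕ) (W : ℕ → ℂ) (w : ℂ),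
    (∀ j : ℕ, j < D → W j ∈ (sInf {K : IntermediateField ℚ ℂ | algebraicClosure ℚ ℂ ≤ K ∧
      ∀ w ∈ K, Complex.exp w ∈ K} : IntermediateField ℚ ℂ)) →
    (∀ j : ℕ, j < D → IsAlgebraic
      (Algebra.adjoin ℚ (Set.range fun i : Fin j => Complex.exp (W i))) (W j)) →
    LinearIndependent ℚ (fun j : Fin D => W j) →
    AlgebraicIndependent ℚ (fun j : Fin D => Complex.exp (W j)) →
    w ∈ (sInf {K : IntermediateField ℚ ℂ | algebraicClosure ℚ ℂ ≤ K ∧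
      ∀ w ∈ K, Complex.exp w ∈ K} : IntermediateField ℚ ℂ) →
    IsAlgebraic (Algebra.adjoin ℚ (Set.range fun j : Fin D => Complex.exp (W j))) w →
    IsAlgebraic (Algebra.adjoin ℚ (Set.range fun j : Fin D => Complex.exp (W j)))
      (Complex.exp w) →
    ∃ q : Fin D → ℚ, IsAlgebraic ℚ (Complex.exp (w - ∑ j : Fin D, (q j : ℂ) * W j))

/-! ### Registered stubs (`sorry` occurs ONLY in these four theorems) -/

/-- Registered stub 1 — finite sub-towers carry `E` (TRUE, structural; see `Sig.stub_towerBasis`). -/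
theorem stub_towerBasis : Sig.stub_towerBasis := by
  sorry

/-- Registered stub 2 — independent Laurent monomials (TRUE, folklore; see
`Sig.stub_laurentMonomials`). -/
theorem stub_laurentMonomials : Sig.stub_laurentMonomials := by
  sorry

/-- Registered stub 3 — **Hermite–Lindemann up the tower** (OPEN): literally the route item
`LogFreeTower` (stmt-Schanuel-5987, crux #4: `u ∈ E`, `e^u ∈ ℚ̄ ⟹ u = 0`), the LOG SECTOR of the
dichotomy; the route reaches it through `GalExtTower` by Kummer theory (support `GalExtImpliesLogFree`).
It closes by name (`theorem … : LogFreeTower`) when that item is proved. -/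
theorem stub_logFreeTower : LogFreeTower := by
  sorry

/-- Registered stub 4 — the generic step modulo logarithms (OPEN, load-bearing; see
`Sig.stub_stepModLogs`). -/
theorem stub_stepModLogs : Sig.stub_stepModLogs := by
  sorry

/-! ### Sorry-free infrastructure for the composition -/

set_option quotPrecheck false in
/-- `E`, as local notation inside the proofs below (verbatim the route's inlined set). -/
local notation "𝔼" => (sInf {K : IntermediateField ℚ ℂ | algebraicClosure ℚ ℂ ≤ K ∧
      ∀ w ∈ K, Complex.exp w ∈ K} : IntermediateField ℚ ℂ)

/-- **Genericity of independent finite sub-towers from the two open stubs.** If `W 0,…,W (D-1) ∈ E`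
is a ℚ-linearly independent finite sub-tower then, assuming `LogFreeTower` and `Sig.stub_stepModLogs`,
every prefix `e^{W 0},…,e^{W (d-1)}` (`d ≤ D`) is algebraically independent over `ℚ`. Induction on
`d`: if `e^{W d}` were algebraic over `ℚ[e^{W 0..d-1}]` (the prefix being generic by induction and
`W d` algebraic over it by the sub-tower property), `stub_stepModLogs` gives `q` with
`e^{W d − Σ q j W j} ∈ ℚ̄`, `LogFreeTower` forces `W d = Σ q j W j`, contradicting linear independence
(`linearIndependent_finSnoc`); so `e^{W d}` is transcendental over the prefix and
`AlgebraicIndependent.option_iff_transcendental` extends genericity (`finSuccEquivLast`). [folklore] -/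
theorem algIndep_exp_prefix (hLog : LogFreeTower) (hStep : Sig.stub_stepModLogs)
    {D : ℕ} {W : ℕ → ℂ}
    (hWE : ∀ j : ℕ, j < D → W j ∈ 𝔼)
    (hT : ∀ j : ℕ, j < D → IsAlgebraic
      (Algebra.adjoin ℚ (Set.range fun i : Fin j => Complex.exp (W i))) (W j))
    (hlin : LinearIndependent ℚ (fun j : Fin D => W j)) :
    ∀ d : ℕ, d ≤ D → AlgebraicIndependent ℚ (fun j : Fin d => Complex.exp (W j)) := by
  intro d
  induction d with
  | zero =>
    intro _
    exact algebraicIndependent_empty_type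
  | succ d ih =>
    intro hd
    have hd' : d < D := hd
    have ihd := ih hd'.le
    -- the new exponential is transcendental over the previous ones
    have htr : Transcendental (Algebra.adjoin ℚ (Set.range fun j : Fin d => Complex.exp (W j)))
        (Complex.exp (W d)) := by
      intro halg
      have hWE' : ∀ j : ℕ, j < d → W j ∈ 𝔼 := fun j hj => hWE j (hj.trans hd')
      have hT' : ∀ j : ℕ, j < d → IsAlgebraic
          (Algebra.adjoin ℚ (Set.range fun i : Fin j => Complex.exp (W i))) (W j) :=
        fun j hj => hT j (hj.trans hd')
      have hlin' : LinearIndependent ℚ (fun j : Fin d => W j) :=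
        hlin.comp (Fin.castLE hd'.le) (Fin.castLE_injective _)
      obtain ⟨q, hq⟩ := hStep d W (W d) hWE' hT' hlin' ihd (hWE d hd') (hT d hd') halg
      have huE : W d - ∑ j : Fin d, (q j : ℂ) * W j ∈ 𝔼 :=
        sub_mem (hWE d hd') (sum_mem fun j _ =>
          mul_mem (SubfieldClass.ratCast_mem _ (q j)) (hWE' j j.isLt))
      have hu0 := hLog _ huE hq
      have hWd : W d = ∑ j : Fin d, (q j : ℂ) * W j := sub_eq_zero.mp hu0
      -- contradiction with the linear independence of the first `d+1` entries
      have hlin1 : LinearIndependent ℚ (fun j : Fin (d + 1) => W j) :=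
        hlin.comp (Fin.castLE hd) (Fin.castLE_injective _)
      have hsnoc : (Fin.snoc (fun j : Fin d => W j) (W d) : Fin (d + 1) → ℂ) =
          fun j : Fin (d + 1) => W j := by
        funext j
        refine Fin.lastCases ?_ (fun i => ?_) j
        · simp [Fin.snoc_last]
        · simp [Fin.snoc_castSucc]
      rw [← hsnoc, linearIndependent_finSnoc] at hlin1
      refine hlin1.2 ?_
      rw [hWd]
      refine Submodule.sum_mem _ fun j _ => ?_
      rw [← Rat.smul_def]
      exact Submodule.smul_mem _ _ (Submodule.subset_span ⟨j, rfl⟩)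
    have hopt := (ihd.option_iff_transcendental (Complex.exp (W d))).mpr htr
    have hkey : ((fun o : Option (Fin d) => o.elim (Complex.exp (W d))
        (fun j : Fin d => Complex.exp (W j))) ∘ finSuccEquivLast) =
        fun j : Fin (d + 1) => Complex.exp (W j) := by
      funext j
      refine Fin.lastCases ?_ (fun i => ?_) j
      · simp [finSuccEquivLast_last]
      · simp [finSuccEquivLast_castSucc]
    exact (algebraicIndependent_equiv' finSuccEquivLast hkey).mpr hopt

/-- The rows of an integer matrix expressing a ℚ-linearly independent tuple `z` in terms of a tuple
`W` are ℚ-linearly independent (a ℚ-relation among the rows is a ℚ-relation among the `z i`).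
[folklore] -/
theorem rows_linearIndependent {n D : ℕ} {z : Fin n → ℂ} {W : ℕ → ℂ} {A : Fin n → Fin D → ℤ}
    (hlin : LinearIndependent ℚ z) (hzA : ∀ i, z i = ∑ j : Fin D, (A i j : ℂ) * W j) :
    LinearIndependent ℚ (fun i => fun j => (A i j : ℚ)) := by
  rw [Fintype.linearIndependent_iff]
  intro g hg i
  have hcol : ∀ j : Fin D, ∑ i, g i * (A i j : ℚ) = 0 := by
    intro j
    have := congrFun hg j
    simpa [Finset.sum_apply, Pi.smul_apply, smul_eq_mul] using this
  have hz0 : ∑ i, g i • z i = 0 := by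
    calc ∑ i, g i • z i = ∑ i, (g i : ℂ) * ∑ j : Fin D, (A i j : ℂ) * W j := by
          refine Finset.sum_congr rfl fun i _ => ?_
          rw [Rat.smul_def, hzA i]
      _ = ∑ j : Fin D, (∑ i, (g i : ℂ) * (A i j : ℂ)) * W j := by
          simp_rw [Finset.mul_sum, Finset.sum_mul, mul_assoc]
          rw [Finset.sum_comm]
      _ = ∑ j : Fin D, ((∑ i, g i * (A i j : ℚ) : ℚ) : ℂ) * W j := by
          push_cast; rfl
      _ = 0 := by simp [hcol]
  exact (Fintype.linearIndependent_iff.mp hlin) g hz0 i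

/-- From algebraically independent exponentials to the crux's conclusion: if `e^{z 0},…,e^{z (n-1)}`
are algebraically independent over `ℚ` then `n ≤ trdeg_ℚ ℚ(z, e^z)` (the family lands in the
intermediate field; `AlgebraicIndependent.of_comp` along the inclusion and
`AlgebraicIndependent.cardinalMk_le_trdeg`). [folklore] -/
theorem le_trdeg_of_algIndep_exp {n : ℕ} {z : Fin n → ℂ}
    (h : AlgebraicIndependent ℚ (fun i => Complex.exp (z i))) :
    (n : Cardinal) ≤ Algebra.trdeg ℚ
      ↥(IntermediateField.adjoin ℚ (Set.range z ∪ Set.range (Complex.exp ∘ z))) := by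
  set L : IntermediateField ℚ ℂ :=
    IntermediateField.adjoin ℚ (Set.range z ∪ Set.range (Complex.exp ∘ z)) with hL
  have hmem : ∀ i, Complex.exp (z i) ∈ L := fun i =>
    IntermediateField.subset_adjoin ℚ _ (Or.inr ⟨i, rfl⟩)
  let x : Fin n → L := fun i => ⟨Complex.exp (z i), hmem i⟩
  have hx : AlgebraicIndependent ℚ x := by
    refine AlgebraicIndependent.of_comp L.val ?_
    exact h
  have := hx.cardinalMk_le_trdeg
  simpa using this

/-! ### Composition -/

/-- **The line closes the crux BY NAME modulo the four registered stubs** (sorry-free; the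
implication content of the skeleton). Given `z ⊂ E` ℚ-independent: `stub_towerBasis` writes
`z = A·W` over a ℚ-independent finite sub-tower `W ⊂ E`; `algIndep_exp_prefix` (from `LogFreeTower` +
`stub_stepModLogs`) makes `W` generic; the rows of `A` are ℚ-independent (`rows_linearIndependent`);
`stub_laurentMonomials` makes `e^{z i} = Π_j (e^{W j})^{A i j}` (`Complex.exp_sum`,
`Complex.exp_int_mul`) algebraically independent; `le_trdeg_of_algIndep_exp` concludes. -/
theorem TowerSchanuel_of :
    Sig.stub_towerBasis → Sig.stub_laurentMonomials → LogFreeTower → Sig.stub_stepModLogs →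
      TowerSchanuel := by
  intro hBasis hMono hLog hStep n z hzE hlin
  obtain ⟨D, W, A, hWE, hT, hWlin, hzA⟩ := hBasis n z hzE hlin
  -- every ℚ-independent finite sub-tower is generic
  have hgen : AlgebraicIndependent ℚ (fun j : Fin D => Complex.exp (W j)) :=
    algIndep_exp_prefix hLog hStep hWE hT hWlin D le_rfl
  -- the exponentials of `z` are independent Laurent monomials in those of `W`
  have hrows := rows_linearIndependent hlin hzA
  have hmono := hMono n D (fun j : Fin D => Complex.exp (W j)) A hgen
    (fun j => Complex.exp_ne_zero _) hrows
  have hexpz : (fun i => ∏ j : Fin D, Complex.exp (W j) ^ (A i j)) =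
      fun i => Complex.exp (z i) := by
    funext i
    rw [hzA i, Complex.exp_sum]
    refine Finset.prod_congr rfl fun j _ => ?_
    exact (Complex.exp_int_mul (W j) (A i j)).symm
  rw [hexpz] at hmono
  -- hence `trdeg ≥ n`
  exact le_trdeg_of_algIndep_exp hmono

/-- The skeleton in its final shape (D-0027 §3.3): the crux BY NAME from the four registered stubs;
it becomes the crux proof when the last `stub_*` is discharged (until then it depends on `sorryAx`
through the stubs only — no `sorry` of its own). -/
theorem TowerSchanuel_proof : TowerSchanuel :=
  TowerSchanuel_of stub_towerBasis stub_laurentMonomials stub_logFreeTower stub_stepModLogs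

/-! ### Special case (BC5-style evidence, sorry-free): the bottom of the tower -/

/-- **Level 0 of the crux is a theorem.** TowerSchanuel for tuples of ALGEBRAIC numbers
(`z ⊂ ℚ̄ = E₀ ⊂ E`): the tree's Lindemann–Weierstrass `LindemannWeierstrass.AlgIndep_holds` makes
`e^{z 0},…,e^{z (n-1)}` algebraically independent, and `le_trdeg_of_algIndep_exp` (the same last step
as in `TowerSchanuel_of`) gives `n ≤ trdeg_ℚ ℚ(z, e^z)`. Shows the definitions compute and the crux is
inhabited in kind. [BakerTNT1975] -/
theorem towerSchanuel_of_algebraic (n : ℕ) (z : Fin n → ℂ) (halg : ∀ i, IsAlgebraic ℚ (z i))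
    (hlin : LinearIndependent ℚ z) :
    (n : Cardinal) ≤ Algebra.trdeg ℚ
      ↥(IntermediateField.adjoin ℚ (Set.range z ∪ Set.range (Complex.exp ∘ z))) :=
  le_trdeg_of_algIndep_exp
    (Literature.NumberTheory.Transcendental.LindemannWeierstrass.AlgIndep_holds n z halg hlin)

end Summit.Schanuel.Schanuel.Cruxes.TowerSchanuel.Birth

end
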